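import Literature.Analysis.FluidPDE.ClassicalLocalEnergyCutoff
import HarnessLib

/-!
# The localised kinetic energy of a classical solution cannot jump up: the flux form of the
# local energy identity and the pointwise-in-time bound of the flux

Analysis/FluidPDE proof file (theorems only; no definitions, no named facts), a sequel of
`ClassicalLocalEnergyCutoff.lean` (the integrated local energy identity
`IsClassicalNSSolutionOn.local_energy_identity_cutoff` of a classical solution of the unforced
Navier–Stokes system against a time-independent cut-off `φ ∈ C_c^∞(E)`). It serves the
discharge path of the named fact `Literature.Analysis.FluidPDE.seregin_sverak_2002`
(`SereginSverakPressure.lean`; G. Seregin, V. Šverák, Arch. Ration. Mech. Anal. **163** (2002)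
65–86), where it is the input of the step "largeness of the scaled energy at a singular point
propagates backward in time over parabolic windows" of the blow-up argument: between two times
`t₀ ≤ t₁` the weighted energy `∫ φ |u|²` can grow only by the time integral of the flux, and the
flux at each time is bounded by three scale-invariant quantities.

* `IsClassicalNSSolutionOn.integral_cutoff_norm_sq_sub_le` — **dropping the dissipation**: for
  `φ ≥ 0` and `ν ≥ 0`,
  `∫ φ|u(t₁)|² − ∫ φ|u(t₀)|² ≤ ∫_{t₀}^{t₁} ∫ (νΔφ|u|² + Dφ(u)|u|² + 2 p Dφ(u))`;
* `IsClassicalNSSolutionOn.integral_pressure_flux_eq_sub_const` — **gauge freedom of the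
  pressure flux**: `∫ p Dφ(u) = ∫ (p − c) Dφ(u)` for every constant `c`, because the slices of
  a classical solution are weakly divergence free (`∫ Dφ(u) = ∫ ⟪u, ∇φ⟫ = 0`);
* `IsClassicalNSSolutionOn.integral_flux_le` — **the pointwise-in-time flux bound**: for every
  `t ∈ S` and every constant `c`,
  `∫ (νΔφ|u|² + Dφ(u)|u|² + 2 p Dφ(u)) ≤ |ν| ∫ |Δφ| |u|² + ∫ ‖Dφ‖ |u|³ + 2 ∫ |p − c| ‖Dφ‖ |u|`.

The time integration of the last bound with the scale-invariant (Type I) window estimates is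
left to the user (it is where measurability of the chosen gauge `c(t)` enters).

## References

* L. Caffarelli, R. Kohn, L. Nirenberg, CPAM 35 (1982), §2, (2.5) (local energy inequality; with
  equality for smooth solutions). [CaffarelliKohnNirenberg1982]
* G. Seregin, V. Šverák, Arch. Ration. Mech. Anal. 163 (2002), 65–86 (the result served).
  [SereginSverak2002]
-/

noncomputable section

open MeasureTheory TopologicalSpace Set Function Filter Metric
open _root_.Topology
open scoped Laplacian InnerProductSpace RealInnerProductSpace ENNReal NNReal ContDiff

namespace Literature.Analysis.FluidPDE

variable {E : Type*} [NormedAddCommGroup E] [InnerProductSpace ℝ E] [FiniteDimensional ℝ E]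
  [MeasurableSpace E] [BorelSpace E]

variable {S : Set ℝ} {ν : ℝ} {u : ℝ → E → E} {p : ℝ → E → ℝ}

/-! ### Dropping the dissipation -/

/-- **The localised energy cannot jump up by more than the flux.** For a classical solution of
the unforced Navier–Stokes system with viscosity `ν ≥ 0` on an open time set `S`, a cut-off
`0 ≤ φ ∈ C_c^∞(E)` and `t₀ ≤ t₁` with `[t₀, t₁] ⊆ S`:
`∫ φ|u(t₁)|² − ∫ φ|u(t₀)|² ≤ ∫_{t₀}^{t₁} ∫ (νΔφ |u|² + Dφ(u)|u|² + 2 p Dφ(u))`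
(the local energy identity `local_energy_identity_cutoff` with the dissipation
`2ν ∫∫ |∇u|² φ ≥ 0` dropped). [cite: CaffarelliKohnNirenberg1982, §2 (2.5)] -/
theorem IsClassicalNSSolutionOn.integral_cutoff_norm_sq_sub_le
    (h : IsClassicalNSSolutionOn S ν 0 u p) (hS : IsOpen S) (hν : 0 ≤ ν) {φ : E → ℝ}
    (hφ : ContDiff ℝ ∞ φ) (hφc : HasCompactSupport φ) (hφ0 : ∀ x, 0 ≤ φ x) {t₀ t₁ : ℝ}
    (ht₀₁ : t₀ ≤ t₁) (hI : Icc t₀ t₁ ⊆ S) :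
    (∫ x, φ x * ‖u t₁ x‖ ^ 2) - (∫ x, φ x * ‖u t₀ x‖ ^ 2) ≤
      ∫ s in t₀..t₁, ∫ x, (ν * ((Δ φ) x * ‖u s x‖ ^ 2) +
        fderiv ℝ φ x (u s x) * ‖u s x‖ ^ 2 + 2 * (p s x * fderiv ℝ φ x (u s x))) := by
  have hid := h.local_energy_identity_cutoff hS hφ hφc ht₀₁ hI
  have hdiss : 0 ≤ 2 * ν * ∫ s in t₀..t₁, ∫ x, frobeniusNormSq (fderiv ℝ (u s) x) * φ x := by
    refine mul_nonneg (by positivity) (intervalIntegral.integral_nonneg ht₀₁ fun s _ => ?_)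
    exact integral_nonneg fun x => mul_nonneg (frobeniusNormSq_nonneg _) (hφ0 x)
  linarith

/-! ### The gauge freedom of the pressure flux -/

omit [MeasurableSpace E] [BorelSpace E] in
/-- A `C¹` divergence-free field is weakly divergence free (the tree's discharged
`VectorCalculus.IsDivFree.isWeaklyDivFree_holds`); in particular the slices of a classical
solution are. [folklore] -/
theorem IsClassicalNSSolutionOn.isWeaklyDivFree_slice' [MeasurableSpace E] [BorelSpace E]
    {f : ℝ → E → E} (h : IsClassicalNSSolutionOn S ν f u p) {t : ℝ} (ht : t ∈ S) :
    IsWeaklyDivFree (u t) :=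
  VectorCalculus.IsDivFree.isWeaklyDivFree_holds (h.divFree t ht)
    (contDiff_infty.1 (h.contDiff_velocity ht) 1)

/-- **`∫ Dφ(u(t)) = 0`** for the slices of a classical solution and `φ ∈ C_c^∞(E)`
(`Dφ(u) = ⟪u, ∇φ⟫`, weak divergence-freeness). [folklore] -/
theorem IsClassicalNSSolutionOn.integral_fderiv_apply_eq_zero {f : ℝ → E → E}
    (h : IsClassicalNSSolutionOn S ν f u p) {φ : E → ℝ} (hφ : ContDiff ℝ ∞ φ)
    (hφc : HasCompactSupport φ) {t : ℝ} (ht : t ∈ S) :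
    ∫ x, fderiv ℝ φ x (u t x) = 0 := by
  have hdiv := h.isWeaklyDivFree_slice' ht φ ⟨hφ, hφc, by simp⟩
  rw [← hdiv]
  refine integral_congr_ae (Eventually.of_forall fun x => ?_)
  show fderiv ℝ φ x (u t x) = ⟪u t x, gradient φ x⟫
  rw [real_inner_comm, gradient, InnerProductSpace.toDual_symm_apply]

/-- **Gauge freedom of the pressure flux**: for `t ∈ S`, `φ ∈ C_c^∞(E)` and every constant `c`,
`∫ p(t) Dφ(u(t)) = ∫ (p(t) − c) Dφ(u(t))` (the difference is `c ∫ Dφ(u) = 0`). In particular the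
pressure in the local energy flux may be replaced by any normalisation `p − c(t)`. [folklore] -/
theorem IsClassicalNSSolutionOn.integral_pressure_flux_eq_sub_const {f : ℝ → E → E}
    (h : IsClassicalNSSolutionOn S ν f u p) {φ : E → ℝ} (hφ : ContDiff ℝ ∞ φ)
    (hφc : HasCompactSupport φ) {t : ℝ} (ht : t ∈ S) (c : ℝ) :
    ∫ x, p t x * fderiv ℝ φ x (u t x) = ∫ x, (p t x - c) * fderiv ℝ φ x (u t x) := by
  have hφ1 : ContDiff ℝ 1 φ := hφ.of_le (by norm_cast)
  have hDφ : Continuous (fderiv ℝ φ) := hφ1.continuous_fderiv one_ne_zero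
  have hu : Continuous (u t) := (h.contDiff_velocity ht).continuous
  have hp : Continuous (p t) := (h.contDiff_pressure ht).continuous
  -- the pairing `x ↦ Dφ(x)(u t x)` is continuous with compact support
  have hDc : Continuous fun x => fderiv ℝ φ x (u t x) := hDφ.clm_apply hu
  have hDs : HasCompactSupport fun x => fderiv ℝ φ x (u t x) := by
    refine (hφc.fderiv (𝕜 := ℝ)).mono ?_
    intro x hx
    simp only [mem_support, ne_eq] at hx ⊢
    intro h0
    exact hx (by rw [h0]; simp)
  have hI1 : Integrable fun x => p t x * fderiv ℝ φ x (u t x) :=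
    (hp.mul hDc).integrable_of_hasCompactSupport hDs.mul_left
  have hI2 : Integrable fun x => c * fderiv ℝ φ x (u t x) :=
    (continuous_const.mul hDc).integrable_of_hasCompactSupport hDs.mul_left
  have hzero := h.integral_fderiv_apply_eq_zero hφ hφc ht
  calc ∫ x, p t x * fderiv ℝ φ x (u t x)
      = (∫ x, p t x * fderiv ℝ φ x (u t x)) - c * ∫ x, fderiv ℝ φ x (u t x) := by
        rw [hzero, mul_zero, sub_zero]
    _ = (∫ x, p t x * fderiv ℝ φ x (u t x)) - ∫ x, c * fderiv ℝ φ x (u t x) := by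
        rw [integral_const_mul]
    _ = ∫ x, (p t x * fderiv ℝ φ x (u t x) - c * fderiv ℝ φ x (u t x)) :=
        (integral_sub hI1 hI2).symm
    _ = ∫ x, (p t x - c) * fderiv ℝ φ x (u t x) :=
        integral_congr_ae (Eventually.of_forall fun x => by ring)

/-! ### The pointwise-in-time flux bound -/

/-- **The flux at a fixed time is bounded by three scale-invariant quantities.** For a classical
solution of the unforced system on `S`, `t ∈ S`, `φ ∈ C_c^∞(E)` and every constant `c`:
`∫ (νΔφ|u|² + Dφ(u)|u|² + 2 p Dφ(u)) ≤ |ν| ∫ |Δφ| |u|² + ∫ ‖Dφ‖ |u|³ + 2 ∫ |p − c| ‖Dφ‖ |u|`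
(gauge freedom for the pressure term, then `|Dφ(x)(v)| ≤ ‖Dφ(x)‖ ‖v‖`). All three integrands are
continuous with compact support. [folklore] -/
theorem IsClassicalNSSolutionOn.integral_flux_le
    (h : IsClassicalNSSolutionOn S ν 0 u p) {φ : E → ℝ} (hφ : ContDiff ℝ ∞ φ)
    (hφc : HasCompactSupport φ) {t : ℝ} (ht : t ∈ S) (c : ℝ) :
    ∫ x, (ν * ((Δ φ) x * ‖u t x‖ ^ 2) +
        fderiv ℝ φ x (u t x) * ‖u t x‖ ^ 2 + 2 * (p t x * fderiv ℝ φ x (u t x))) ≤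
      |ν| * (∫ x, |(Δ φ) x| * ‖u t x‖ ^ 2) + (∫ x, ‖fderiv ℝ φ x‖ * ‖u t x‖ ^ 3) +
        2 * ∫ x, |p t x - c| * ‖fderiv ℝ φ x‖ * ‖u t x‖ := by
  have hφ2 : ContDiff ℝ 2 φ := hφ.of_le (by norm_cast)
  have hφ1 : ContDiff ℝ 1 φ := hφ.of_le (by norm_cast)
  have hΔφ : Continuous (Δ φ) := continuous_laplacian hφ2
  have hDφ : Continuous (fderiv ℝ φ) := hφ1.continuous_fderiv one_ne_zero
  have hu : Continuous (u t) := (h.contDiff_velocity ht).continuous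
  have hp : Continuous (p t) := (h.contDiff_pressure ht).continuous
  -- supports
  have hΔ0 : ∀ x ∉ tsupport φ, (Δ φ) x = 0 := fun x hx => laplacian_eq_zero_of_notMem_tsupport hx
  have hD0 : ∀ x ∉ tsupport φ, fderiv ℝ φ x = 0 := fun x hx => fderiv_of_notMem_tsupport ℝ hx
  have hK : IsCompact (tsupport φ) := hφc
  -- the six continuous compactly supported integrands
  have cT1 : Continuous fun x => ν * ((Δ φ) x * ‖u t x‖ ^ 2) :=
    continuous_const.mul (hΔφ.mul (hu.norm.pow 2))
  have cT2 : Continuous fun x => fderiv ℝ φ x (u t x) * ‖u t x‖ ^ 2 :=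
    (hDφ.clm_apply hu).mul (hu.norm.pow 2)
  have cT3 : Continuous fun x => 2 * ((p t x - c) * fderiv ℝ φ x (u t x)) :=
    continuous_const.mul ((hp.sub continuous_const).mul (hDφ.clm_apply hu))
  have cB1 : Continuous fun x => |(Δ φ) x| * ‖u t x‖ ^ 2 :=
    (continuous_abs.comp hΔφ).mul (hu.norm.pow 2)
  have cB2 : Continuous fun x => ‖fderiv ℝ φ x‖ * ‖u t x‖ ^ 3 := hDφ.norm.mul (hu.norm.pow 3)
  have cB3 : Continuous fun x => |p t x - c| * ‖fderiv ℝ φ x‖ * ‖u t x‖ :=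
    ((continuous_abs.comp (hp.sub continuous_const)).mul hDφ.norm).mul hu.norm
  have sT1 : HasCompactSupport fun x => ν * ((Δ φ) x * ‖u t x‖ ^ 2) :=
    HasCompactSupport.intro hK fun x hx => by rw [hΔ0 x hx]; simp
  have sT2 : HasCompactSupport fun x => fderiv ℝ φ x (u t x) * ‖u t x‖ ^ 2 :=
    HasCompactSupport.intro hK fun x hx => by rw [hD0 x hx]; simp
  have sT3 : HasCompactSupport fun x => 2 * ((p t x - c) * fderiv ℝ φ x (u t x)) :=
    HasCompactSupport.intro hK fun x hx => by rw [hD0 x hx]; simp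
  have sB1 : HasCompactSupport fun x => |(Δ φ) x| * ‖u t x‖ ^ 2 :=
    HasCompactSupport.intro hK fun x hx => by rw [hΔ0 x hx]; simp
  have sB2 : HasCompactSupport fun x => ‖fderiv ℝ φ x‖ * ‖u t x‖ ^ 3 :=
    HasCompactSupport.intro hK fun x hx => by rw [hD0 x hx]; simp
  have sB3 : HasCompactSupport fun x => |p t x - c| * ‖fderiv ℝ φ x‖ * ‖u t x‖ :=
    HasCompactSupport.intro hK fun x hx => by rw [hD0 x hx]; simp
  have iT1 := cT1.integrable_of_hasCompactSupport (μ := volume) sT1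
  have iT2 := cT2.integrable_of_hasCompactSupport (μ := volume) sT2
  have iT3 := cT3.integrable_of_hasCompactSupport (μ := volume) sT3
  have iB1 := cB1.integrable_of_hasCompactSupport (μ := volume) sB1
  have iB2 := cB2.integrable_of_hasCompactSupport (μ := volume) sB2
  have iB3 := cB3.integrable_of_hasCompactSupport (μ := volume) sB3
  have i12 : Integrable (fun x => ν * ((Δ φ) x * ‖u t x‖ ^ 2) +
      fderiv ℝ φ x (u t x) * ‖u t x‖ ^ 2) := iT1.add iT2
  -- gauge the pressure term
  have hgauge : ∫ x, (ν * ((Δ φ) x * ‖u t x‖ ^ 2) +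
      fderiv ℝ φ x (u t x) * ‖u t x‖ ^ 2 + 2 * (p t x * fderiv ℝ φ x (u t x))) =
      ∫ x, (ν * ((Δ φ) x * ‖u t x‖ ^ 2) +
        fderiv ℝ φ x (u t x) * ‖u t x‖ ^ 2 + 2 * ((p t x - c) * fderiv ℝ φ x (u t x))) := by
    have hT3' : Integrable fun x => 2 * (p t x * fderiv ℝ φ x (u t x)) := by
      have c' : Continuous fun x => 2 * (p t x * fderiv ℝ φ x (u t x)) :=
        continuous_const.mul (hp.mul (hDφ.clm_apply hu))
      exact c'.integrable_of_hasCompactSupport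
        (HasCompactSupport.intro hK fun x hx => by rw [hD0 x hx]; simp)
    rw [integral_add i12 hT3', integral_add i12 iT3, integral_const_mul,
      integral_const_mul, h.integral_pressure_flux_eq_sub_const hφ hφc ht c]
  rw [hgauge, integral_add i12 iT3, integral_add iT1 iT2, integral_const_mul,
    integral_const_mul]
  -- the three pointwise bounds
  have b1 : ν * ∫ x, (Δ φ) x * ‖u t x‖ ^ 2 ≤ |ν| * ∫ x, |(Δ φ) x| * ‖u t x‖ ^ 2 := by
    have hle : |∫ x, (Δ φ) x * ‖u t x‖ ^ 2| ≤ ∫ x, |(Δ φ) x| * ‖u t x‖ ^ 2 := by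
      refine (abs_integral_le_integral_abs).trans (le_of_eq (integral_congr_ae
        (Eventually.of_forall fun x => ?_)))
      simp only [abs_mul, abs_pow, abs_norm]
    calc ν * ∫ x, (Δ φ) x * ‖u t x‖ ^ 2 ≤ |ν * ∫ x, (Δ φ) x * ‖u t x‖ ^ 2| := le_abs_self _
      _ = |ν| * |∫ x, (Δ φ) x * ‖u t x‖ ^ 2| := abs_mul _ _
      _ ≤ |ν| * ∫ x, |(Δ φ) x| * ‖u t x‖ ^ 2 := mul_le_mul_of_nonneg_left hle (abs_nonneg _)
  have b2 : ∫ x, fderiv ℝ φ x (u t x) * ‖u t x‖ ^ 2 ≤ ∫ x, ‖fderiv ℝ φ x‖ * ‖u t x‖ ^ 3 := by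
    refine integral_mono iT2 iB2 fun x => ?_
    have h1 : fderiv ℝ φ x (u t x) ≤ ‖fderiv ℝ φ x‖ * ‖u t x‖ :=
      (le_abs_self _).trans (by simpa [Real.norm_eq_abs] using (fderiv ℝ φ x).le_opNorm (u t x))
    calc fderiv ℝ φ x (u t x) * ‖u t x‖ ^ 2 ≤ (‖fderiv ℝ φ x‖ * ‖u t x‖) * ‖u t x‖ ^ 2 :=
          mul_le_mul_of_nonneg_right h1 (by positivity)
      _ = ‖fderiv ℝ φ x‖ * ‖u t x‖ ^ 3 := by ring
  have b3 : ∫ x, (p t x - c) * fderiv ℝ φ x (u t x) ≤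
      ∫ x, |p t x - c| * ‖fderiv ℝ φ x‖ * ‖u t x‖ := by
    have iT3' : Integrable fun x => (p t x - c) * fderiv ℝ φ x (u t x) := by
      have := iT3.const_mul (1 / 2)
      refine this.congr (Eventually.of_forall fun x => ?_)
      ring
    refine integral_mono iT3' iB3 fun x => ?_
    have h1 : |fderiv ℝ φ x (u t x)| ≤ ‖fderiv ℝ φ x‖ * ‖u t x‖ := by
      simpa [Real.norm_eq_abs] using (fderiv ℝ φ x).le_opNorm (u t x)
    calc (p t x - c) * fderiv ℝ φ x (u t x) ≤ |(p t x - c) * fderiv ℝ φ x (u t x)| := le_abs_self _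
      _ = |p t x - c| * |fderiv ℝ φ x (u t x)| := abs_mul _ _
      _ ≤ |p t x - c| * (‖fderiv ℝ φ x‖ * ‖u t x‖) :=
          mul_le_mul_of_nonneg_left h1 (abs_nonneg _)
      _ = |p t x - c| * ‖fderiv ℝ φ x‖ * ‖u t x‖ := by ring
  linarith

end Literature.Analysis.FluidPDE

end
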